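import Summits.Ventures.YMGap.RobustBall.PlaquettePositivity
import Summits.Ventures.YMGap.RobustBall.OneStateInvariant
import HarnessLib

/-!
# Venture YMGap, track ROBUST-BALL — ONE STATE (Wilson action): the unique DLR state is the torus limit, translation
# invariant AND invariant under permutations of the lattice axes

HONEST FRAMING. WHAT THIS IS: a venture file (cell `pub-ymgap`, track Y2 / strong coupling, seat ds-3) assembling, for the
WILSON action `W = 0` of `SU(N)` lattice Yang–Mills on `ℤ^d` in the uniqueness regime (`MassGapAt d N β`, first clause), the
symmetries of its one state on the DLR side: the unique DLR state `μ` equals every infinite-volume limit point of the periodic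
torus Wilson states (`ymGibbsMeasures = {μ} = infiniteVolumeLimitPoints`, tree `mem_ymGibbsMeasures_of_mem_infiniteVolumeLimitPoints_holds`
+ `infiniteVolumeLimitPoints_nonempty_holds`), hence inherits their symmetries: TRANSLATION invariance and invariance under every
PERMUTATION OF THE COORDINATE AXES (rb-p2's `PlaquettePositivity.map_configPermZd_eq_of_mem`) — `oneState_symmetric_of_massGapAt`;
cells `su2_wilson_oneState_symmetric` (`SU(2)`, `ℤ⁴`, every `|b| ≤ 9/50`, two-sided) and `suN_wilson_oneState_symmetric_sharp` (every
`N ≥ 2`, `d ≥ 2`, 't Hooft `|β| < 1/(8d)`). WHAT THIS IS NOT: nothing for non-Wilson members (their axis symmetry needs a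
permutation-covariant member AND a permutation-covariance lemma for the perturbed kernels, not in the tree), no reflections; lattice
statements only, nothing about the continuum limit or the Clay Millennium problem.

References: H.-O. Georgii (2011), §5.1, Thm. 4.17; E. Seiler, LNP 159 (1982), Ch. 2; the tree's `LatticeGaugeDLRGibbsProofs.lean`,
`LatticeGaugeStaticPotentialProofs.lean` (`configPermZd`), the track's `PlaquettePositivity.lean`, `OneStateInvariant.lean`.
-/

noncomputable section

open MeasureTheory Filter Function
open Literature.Probability.LatticeModels hiding configShift configShift_apply
open Literature.MathematicalPhysics.QuantumLattice
open Literature.MathematicalPhysics.QuantumFieldTheory hiding ZdEdge Site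

namespace Summit.Ventures.YMGap.RobustBall

variable {d N : ℕ}

/-- ★★ **WILSON ACTION: ONE STATE = TORUS LIMIT, TRANSLATION AND AXIS-PERMUTATION INVARIANT** (every `d ≥ 1`, `N`, `β`). Under
`MassGapAt d N β` there is ONE probability measure `μ` on `SU(N)^{links(ℤ^d)}` with `ymGibbsMeasures = {μ}` (unique DLR state),
`infiniteVolumeLimitPoints = {μ}` (the only subsequential limit of the periodic torus Wilson states), `μ ∘ θ_v⁻¹ = μ` for every
lattice translation and `μ ∘ π⁻¹ = μ` for every permutation `π` of the coordinate axes (`configPermZd π`). [folklore] -/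
theorem oneState_symmetric_of_massGapAt [NeZero d] {β : ℝ} (hgap : MassGapAt d N β) :
    ∃ μ : Measure (LGConfig d (SUN N)),
      ymGibbsMeasures (d := d) (fundamentalRep (Fin N)) ((N : ℝ) * β) = {μ} ∧
      infiniteVolumeLimitPoints (d := d) (fundamentalRep (Fin N)) ((N : ℝ) * β) = {μ} ∧
      IsZdTranslationInvariant μ ∧ ∀ π : Equiv.Perm (Fin d), μ.map (configPermZd π) = μ := by
  obtain ⟨μ, hG, hT⟩ := oneState_translationInvariant_of_massGapAt hgap
  have hρ : Continuous (fundamentalRep (Fin N)) := continuous_fundamentalRep (Fin N)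
  have hsub : (ymGibbsMeasures (d := d) (fundamentalRep (Fin N)) ((N : ℝ) * β)).Subsingleton := by
    rw [hG]; exact Set.subsingleton_singleton
  have hμ : μ ∈ ymGibbsMeasures (d := d) (fundamentalRep (Fin N)) ((N : ℝ) * β) := by rw [hG]; exact Set.mem_singleton μ
  have hdlr : ∀ ν ∈ infiniteVolumeLimitPoints (d := d) (fundamentalRep (Fin N)) ((N : ℝ) * β),
      ν ∈ ymGibbsMeasures (d := d) (fundamentalRep (Fin N)) ((N : ℝ) * β) := fun ν hν =>
    mem_ymGibbsMeasures_of_mem_infiniteVolumeLimitPoints_holds (fundamentalRep (Fin N)) hρ hν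
  obtain ⟨ν, hν⟩ := infiniteVolumeLimitPoints_nonempty_holds (d := d) (fundamentalRep (Fin N)) hρ ((N : ℝ) * β)
  have hνμ : ν = μ := hsub (hdlr ν hν) hμ
  subst hνμ
  refine ⟨ν, hG, Set.eq_singleton_iff_unique_mem.2 ⟨hν, fun ν' hν' => hsub (hdlr ν' hν') hμ⟩, hT, fun π => ?_⟩
  exact PlaquettePositivity.map_configPermZd_eq_of_mem (fundamentalRep (Fin N)) hρ hν π

/-- ★ **`SU(2)` Wilson on `ℤ⁴`, TWO-SIDED, every `|b| ≤ 9/50` (Wilson `|β_W| ≤ 9/25`)**: the one state — unique DLR = torus limit —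
is translation invariant and invariant under every permutation of the four axes. [folklore] -/
theorem su2_wilson_oneState_symmetric {b : ℝ} (h : |b| ≤ 9 / 50) :
    ∃ μ : Measure (LGConfig 4 (SUN 2)),
      ymGibbsMeasures (d := 4) (fundamentalRep (Fin 2)) b = {μ} ∧
      infiniteVolumeLimitPoints (d := 4) (fundamentalRep (Fin 2)) b = {μ} ∧
      IsZdTranslationInvariant μ ∧ ∀ π : Equiv.Perm (Fin 4), μ.map (configPermZd π) = μ := by
  have hm := ImprovedThresholdStar.su2_massGapAt_of_abs_le (β := b / 2) (by rw [abs_div, abs_two]; linarith)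
  have e : (((2 : ℕ) : ℝ)) * (b / 2) = b := by push_cast; ring
  have h := oneState_symmetric_of_massGapAt hm
  rwa [e] at h

/-- ★ **Every `N ≥ 2`, every `d ≥ 2`, the SHARP window `|β| < 1/(8d)`, hypothesis-free**: the one state of `SU(N)` lattice Yang–Mills at
tree coupling `N β` — unique DLR = torus limit — is translation invariant and invariant under every axis permutation. [folklore] -/
theorem suN_wilson_oneState_symmetric_sharp (hd : 2 ≤ d) (hN : 2 ≤ N) {β : ℝ} (hβ : |β| < HessianSharp.sharpThresholdSU d) :
    ∃ μ : Measure (LGConfig d (SUN N)),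
      ymGibbsMeasures (d := d) (fundamentalRep (Fin N)) ((N : ℝ) * β) = {μ} ∧
      infiniteVolumeLimitPoints (d := d) (fundamentalRep (Fin N)) ((N : ℝ) * β) = {μ} ∧
      IsZdTranslationInvariant μ ∧ ∀ π : Equiv.Perm (Fin d), μ.map (configPermZd π) = μ := by
  haveI : NeZero d := ⟨by omega⟩
  exact oneState_symmetric_of_massGapAt (SharpUniquenessJoin.massGapAt_sharp_free hd hN hβ)

end Summit.Ventures.YMGap.RobustBall

end
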